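import Literature.InformationTheory.QuantumCodes.AbelianTwoBlockParameters
import Literature.InformationTheory.QuantumCodes.CSSClassicalBounds
import Literature.InformationTheory.Coding.SubfieldImage
import HarnessLib

/-!
# Wang–Pryadko 2022, Statement 5: the CSS map for generalized-bicycle codes — `[[2ℓ, 2k₀ − 2ℓ, d ≥ d₀]]`
# from the index-two quasi-cyclic code `QC(a,b) = ker H_X`, PROVED for every abelian two-block code

R. Wang, L. P. Pryadko, *Distance bounds for generalized bicycle codes*, Symmetry **14** (2022) 1348 =
arXiv:2203.17216 [WangPryadko2022], §4 (held text `paper:arxiv-2203.17216`, chunk p0007 L1–17), read on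
the page:

> "… relating the parameters of a CSS code to those of the associated pair of classical 𝔽_q-linear mutually
> dual-containing codes. In the case of the code GB(a,b), the two codes have double-circulant parity check
> matrices `H_X` and `H_Z` … we focus on the index-two QC code with the check matrix `H = H_X`, and denote
> such a code QC(a,b).
> **Statement 5** (CSS map for GB codes). Given the parameters `[n₀ = 2ℓ, k₀, d₀]_q` of the classical linear
> code QC(a,b), the quantum CSS code GB(a,b) has parameters `[[2ℓ, 2k₀ − 2ℓ, d]]_q`, where `d ≥ d₀`."

Typed for the tree's binary abelian two-block codes `AbelianTwoBlock.css a b` over ANY finite abelian group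
`G` (GB = `G = ℤ_ℓ`; BB and abelian 2BGA likewise), `n₀ = 2|G|`:

* `AbelianTwoBlock.kerZ_eq_reindex_kerX` — `ker H_Z` is `ker H_X = QC(a,b)` re-indexed by the weight-preserving
  coordinate permutation `colSwap` (`(u | v) ↦ (v̄ | ū)`), hence `minDist_kerZ_eq_minDist_kerX` and
  `finrank_kerZ_eq_finrank_kerX` (the "pair of mutually dual-containing codes" have the same parameters);
* **`AbelianTwoBlock.WangPryadko2022_statement5_k`** — `k + 2ℓ = 2k₀` (additive form of `k = 2k₀ − 2ℓ`);
* **`AbelianTwoBlock.WangPryadko2022_statement5_d`** — `d₀ ≤ d(QC(a,b))` ⟹ `d₀ ≤ min(d_X, d_Z)` (for `k > 0`;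
  `ℕ∞`-form `minDist_kerX_le_css_dZ/dX`).

Assembled from the general CSS map of `CSSClassicalBounds.lean` (`CSSCode.k_add_card`,
`CSSCode.le_min_dX_dZ_of_le_minDist`) and the `X/Z` symmetry of abelian two-block codes
(`AbelianTwoBlockCodes.lean`: `HZ_mulVec_eq_zero_iff`, `hammingNorm_comp_colSwap`). No named facts, no instances.
Census bearing: a THEOREM∘KERNEL lane for GB/BB/abelian-2BGA rows needing ONE classical distance certificate
(for `ker H_X`) instead of two, and `k` from the classical dimension `k₀`.

## References (locators read on the page)
* [WangPryadko2022] arXiv:2203.17216, §4 Statement 5 (chunk p0007 L1–17).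
* [CalderbankShor1996], [Steane1996] — the CSS map (tree `CSSClassicalBounds.lean`).
-/

namespace Literature.InformationTheory.QuantumCodes

namespace AbelianTwoBlock

open Matrix
open Literature.InformationTheory.Coding (minDist minDist_reindex)

variable {G : Type*} [Fintype G] [AddCommGroup G]

/-- **`ker H_Z = ker H_X ∘ colSwap`**: the second classical code of the CSS pair is the index-two QC code
`QC(a,b) = ker H_X` with its coordinates permuted by `(u | v) ↦ (v(−·) | u(−·))`.
[cite: WangPryadko2022, §4 before Statement 5 (arXiv:2203.17216 chunk p0007 L5–10: "the two codes have double-circulant parity check matrices H_X and H_Z")] -/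
theorem kerZ_eq_reindex_kerX (a b : G → ZMod 2) :
    (css a b).kerZ = Coding.reindex (colSwap G) (css a b).kerX := by
  ext v
  rw [CSSCode.mem_kerZ_iff, Coding.mem_reindex_iff, css_HZ, HZ_mulVec_eq_zero_iff]
  exact (CSSCode.mem_kerX_iff (css a b) _).symm

/-- `d(ker H_Z) = d(ker H_X) = d₀`. [cite: WangPryadko2022, §4 Statement 5 (arXiv:2203.17216 chunk p0007 L13–17)] -/
theorem minDist_kerZ_eq_minDist_kerX (a b : G → ZMod 2) :
    minDist (css a b).kerZ = minDist (css a b).kerX := by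
  rw [kerZ_eq_reindex_kerX, minDist_reindex]

/-- `dim ker H_Z = dim ker H_X = k₀`. [cite: WangPryadko2022, §4 Statement 5 (arXiv:2203.17216 chunk p0007 L13–17)] -/
theorem finrank_kerZ_eq_finrank_kerX (a b : G → ZMod 2) :
    Module.finrank (ZMod 2) (css a b).kerZ = Module.finrank (ZMod 2) (css a b).kerX := by
  rw [kerZ_eq_reindex_kerX]
  unfold Literature.InformationTheory.Coding.reindex
  exact LinearEquiv.finrank_map_eq _ _

/-- **Statement 5, dimension: `k = 2k₀ − 2ℓ`** (additively: `k + 2ℓ = 2k₀`, `ℓ = |G|`, `k₀ = dim QC(a,b) = dim ker H_X`).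
[cite: WangPryadko2022, Statement 5 (arXiv:2203.17216 chunk p0007 L13–17: «the quantum CSS code GB(a,b) has parameters [[2ℓ, 2k₀−2ℓ, d]]_q»)] -/
theorem WangPryadko2022_statement5_k (a b : G → ZMod 2) :
    (css a b).k + 2 * Fintype.card G = 2 * Module.finrank (ZMod 2) (css a b).kerX := by
  have h := (css a b).k_add_card
  rw [Fintype.card_sum, finrank_kerZ_eq_finrank_kerX] at h
  omega

/-- **Statement 5, distance: `d ≥ d₀`** — a lower bound `d₀ ≤ d(QC(a,b))` on the classical distance of
`ker H_X` bounds both CSS distances below (for `k > 0`).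
[cite: WangPryadko2022, Statement 5 (arXiv:2203.17216 chunk p0007 L13–17: «… where d ≥ d₀»)] -/
theorem WangPryadko2022_statement5_d (a b : G → ZMod 2) (hk : 0 < (css a b).k) {d₀ : ℕ}
    (h : (d₀ : ℕ∞) ≤ minDist (css a b).kerX) : d₀ ≤ min (css a b).dX (css a b).dZ :=
  (css a b).le_min_dX_dZ_of_le_minDist hk (by rwa [minDist_kerZ_eq_minDist_kerX]) h

/-- `ℕ∞`-form, `Z` side: `d(QC(a,b)) ≤ d_Z` whenever a `Z`-logical exists.
[cite: WangPryadko2022, Statement 5 (arXiv:2203.17216 chunk p0007 L13–17)] -/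
theorem minDist_kerX_le_css_dZ (a b : G → ZMod 2) (h : 0 < (css a b).dZ) :
    minDist (css a b).kerX ≤ ((css a b).dZ : ℕ∞) :=
  (css a b).minDist_kerX_le_dZ h

/-- `ℕ∞`-form, `X` side: `d(QC(a,b)) ≤ d_X` whenever an `X`-logical exists (through `ker H_Z ≅ ker H_X`).
[cite: WangPryadko2022, Statement 5 (arXiv:2203.17216 chunk p0007 L13–17)] -/
theorem minDist_kerX_le_css_dX (a b : G → ZMod 2) (h : 0 < (css a b).dX) :
    minDist (css a b).kerX ≤ ((css a b).dX : ℕ∞) := by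
  rw [← minDist_kerZ_eq_minDist_kerX]
  exact (css a b).minDist_kerZ_le_dX h

/-- **Statement 5 as a census row**: if `|G| = ℓ`, `dim QC(a,b) = k₀` with `ℓ < k₀`, every nonzero word of
`QC(a,b)` has weight `≥ d₀`, and some logical operator has weight `d₀`, then `css a b` is EXACTLY
`[[2ℓ, 2k₀ − 2ℓ, d₀]]` (the non-degenerate case `d = d₀` of the printed `d ≥ d₀`).
[cite: WangPryadko2022, Statement 5 (arXiv:2203.17216 chunk p0007 L13–17)] -/
theorem WangPryadko2022_statement5_isCode (a b : G → ZMod 2) {ℓ k₀ d₀ : ℕ} (hℓ : Fintype.card G = ℓ)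
    (hk₀ : Module.finrank (ZMod 2) (css a b).kerX = k₀) (hlt : ℓ < k₀)
    (hd₀ : (d₀ : ℕ∞) ≤ minDist (css a b).kerX)
    (hw : (∃ v : G ⊕ G → ZMod 2, (css a b).HZ *ᵥ v = 0 ∧ v ∉ (css a b).rowSpX ∧ hammingNorm v = d₀) ∨
      (∃ v : G ⊕ G → ZMod 2, (css a b).HX *ᵥ v = 0 ∧ v ∉ (css a b).rowSpZ ∧ hammingNorm v = d₀)) :
    (css a b).IsCode (2 * ℓ) (2 * k₀ - 2 * ℓ) d₀ := by
  have hk : (css a b).k = 2 * k₀ - 2 * ℓ := by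
    have := WangPryadko2022_statement5_k a b
    rw [hℓ, hk₀] at this
    omega
  exact (css a b).isCode_of_minDist_of_witness (by rw [Fintype.card_sum, hℓ]; ring) hk (by omega)
    (by rwa [minDist_kerZ_eq_minDist_kerX]) hd₀ hw

end AbelianTwoBlock

end Literature.InformationTheory.QuantumCodes
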